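import Literature.Computability.Complexity.UniformProbBlocks
import Literature.Probability.Distributions.PseudoGaussianSamplerCoins
import HarnessLib

/-!
# Coin strings as tuples of blocks: the chunk bijections behind a coin-driven machine

Trunk `Computability/Complexity`, companion of `UniformProbBlocks.lean` (`uniformProb` on coin
strings, fresh blocks) and `Probability/Distributions/PseudoGaussianSamplerCoins.lean` (a string of
length `J · A` is determined by its `J` blocks, `eq_of_blocks_eq`). A randomised machine reads its
coin string FIELD BY FIELD — consecutive blocks, each decoded into a structured object (a position
`< 2^μ`, the coins of one sampler run, …); its analysis is done on the structured objects, uniformly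
distributed. This file is the dictionary:

* `chunkVec v t` — block `t` (length `A`) of `v ∈ {0,1}^{J·A}`; **`chunkVec_bijective`** —
  `{0,1}^{J·A} → (Fin J → {0,1}^A)` is a bijection; `card_filter_chunkVec`;
* `bitsFin v` — the value `< 2^μ` of a block of `μ` bits; **`bitsFin_bijective`**;
  `finTuple_bijective` — `{0,1}^{J·μ} → (Fin J → Fin (2^μ))` (uniform positions);
* `matChunk` — `{0,1}^{m·(n·A)} → (Fin m → Fin n → {0,1}^A)` and its bijectivity (uniform arrays);
* `uniformProb_eq_card_of_bijective` — **transfer of `uniformProb` along any such decoding**: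
  `Pr_r[Q (decode r)] = #{s | Q s} / #S` for a bijective `decode : {0,1}^L → S`.

All proved.

## References

* S. Arora, B. Barak, *Computational Complexity: A Modern Approach*, CUP 2009, §7.1 (coins as part
  of the input), §A.2.
* S. Aaronson, A. Arkhipov, *The computational complexity of linear optics*, Theory of Computing 9
  (2013) 143–252, Thm. 1.1 (p. 149) and proof of Thm. 1.3 (§5.2).
-/

namespace Literature.Computability.Complexity

open Finset Literature.Probability.Distributions

/-! ### Transfer of `uniformProb` along a bijective decoding -/

/-- **`Pr_r[Q (decode r)] = #{s | Q s} / #S`** for a bijective decoding of the coin strings of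
length `L` onto a finite type `S`. [cite: AroraBarak2009, §7.1] -/
theorem uniformProb_eq_card_of_bijective {L : ℕ} {S : Type*} [Fintype S] (decode : List.Vector Bool L → S)
    (hb : Function.Bijective decode) (Q : S → Prop) [DecidablePred Q] :
    uniformProb L {w | ∃ h : w.length = L, Q (decode ⟨w, h⟩)} = ((univ.filter Q).card : ℝ) / Fintype.card S := by
  classical
  unfold uniformProb
  have hcard : Fintype.card S = 2 ^ L := by
    rw [← Fintype.card_of_bijective hb, card_vector, Fintype.card_bool]
  rw [hcard]
  push_cast
  congr 1
  norm_cast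
  refine card_bij (fun v _ => decode v) (fun v hv => ?_) (fun v _ w _ h => hb.1 h) fun s hs => ?_
  · simp only [mem_filter, mem_univ, true_and, Set.mem_setOf_eq] at hv ⊢
    obtain ⟨h, hq⟩ := hv
    have : (⟨v.toList, h⟩ : List.Vector Bool L) = v := Subtype.ext rfl
    rwa [this] at hq
  · obtain ⟨v, rfl⟩ := hb.2 s
    refine ⟨v, ?_, rfl⟩
    simp only [mem_filter, mem_univ, true_and, Set.mem_setOf_eq] at hs ⊢
    exact ⟨v.toList_length, by simpa using hs⟩

/-! ### Blocks of a coin string -/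

/-- The length of block `t` of a string of length `J · A` is `A`. [folklore] -/
theorem length_take_drop_of_lt {J A t : ℕ} {w : List Bool} (hw : w.length = J * A) (ht : t < J) :
    ((w.drop (t * A)).take A).length = A := by
  rw [List.length_take, List.length_drop, hw]
  have : (t + 1) * A ≤ J * A := Nat.mul_le_mul_right _ ht
  rw [Nat.succ_mul] at this
  omega

/-- **Block `t` of `v ∈ {0,1}^{J·A}`.** [folklore] -/
def chunkVec {J A : ℕ} (v : List.Vector Bool (J * A)) (t : Fin J) : List.Vector Bool A :=
  ⟨(v.toList.drop (t * A)).take A, length_take_drop_of_lt v.toList_length t.isLt⟩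

/-- The blocks as a list. [folklore] -/
theorem map_range_chunk_eq_ofFn {J A : ℕ} (v : List.Vector Bool (J * A)) :
    (List.range J).map (fun t => (v.toList.drop (t * A)).take A) = List.ofFn fun t => (chunkVec v t).toList := by
  rw [List.ofFn_eq_map, ← List.map_coe_finRange_eq_range, List.map_map]
  rfl

/-- **The chunk map is a bijection** `{0,1}^{J·A} → (Fin J → {0,1}^A)`. [folklore] -/
theorem chunkVec_bijective (J A : ℕ) : Function.Bijective (chunkVec (J := J) (A := A)) := by
  rw [Fintype.bijective_iff_injective_and_card]
  constructor
  · intro v w h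
    apply List.Vector.toList_injective
    refine eq_of_blocks_eq v.toList_length w.toList_length fun t ht => ?_
    have := congrFun h ⟨t, ht⟩
    exact congrArg List.Vector.toList this
  · simp [card_vector, ← pow_mul, mul_comm]

/-- Counting through the chunk map. [folklore] -/
theorem card_filter_chunkVec {J A : ℕ} (Q : (Fin J → List.Vector Bool A) → Prop) [DecidablePred Q] :
    (univ.filter fun v : List.Vector Bool (J * A) => Q (chunkVec v)).card = (univ.filter Q).card := by
  refine card_bij (fun v _ => chunkVec v) (fun v hv => by simpa using hv)
    (fun v _ w _ h => (chunkVec_bijective J A).1 h) fun f hf => ?_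
  obtain ⟨v, rfl⟩ := (chunkVec_bijective J A).2 f
  exact ⟨v, by simpa using hf, rfl⟩

/-! ### A block of `μ` bits as a position `< 2^μ` -/

/-- The value of a block of `μ` bits, in `Fin (2^μ)`. [folklore] -/
def bitsFin {μ : ℕ} (v : List.Vector Bool μ) : Fin (2 ^ μ) :=
  ⟨bitsToNat v.toList, by simpa [v.toList_length] using bitsToNat_lt v.toList⟩

/-- **`bitsFin` is a bijection** `{0,1}^μ → Fin (2^μ)` (so a uniform block is a uniform position).
[folklore] -/
theorem bitsFin_bijective (μ : ℕ) : Function.Bijective (bitsFin (μ := μ)) := by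
  rw [Fintype.bijective_iff_injective_and_card]
  constructor
  · intro v w h
    apply List.Vector.toList_injective
    exact DiagPrelims.eq_of_bitsToNat_eq (by rw [v.toList_length, w.toList_length]) (congrArg Fin.val h)
  · simp [card_vector]

/-- Positions: `{0,1}^{J·μ} → (Fin J → Fin (2^μ))`, block by block. [folklore] -/
def finTuple {J μ : ℕ} (v : List.Vector Bool (J * μ)) (t : Fin J) : Fin (2 ^ μ) := bitsFin (chunkVec v t)

/-- **`finTuple` is a bijection.** [folklore] -/
theorem finTuple_bijective (J μ : ℕ) : Function.Bijective (finTuple (J := J) (μ := μ)) :=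
  (Function.Bijective.comp_left (g := bitsFin) (bitsFin_bijective μ)).comp (chunkVec_bijective J μ)

/-! ### Arrays of blocks -/

/-- Arrays: `{0,1}^{m·(n·A)} → (Fin m → Fin n → {0,1}^A)`, row blocks then entry blocks. [folklore] -/
def matChunk {m n A : ℕ} (v : List.Vector Bool (m * (n * A))) (r : Fin m) (c : Fin n) : List.Vector Bool A :=
  chunkVec (chunkVec v r) c

/-- **`matChunk` is a bijection.** [folklore] -/
theorem matChunk_bijective (m n A : ℕ) : Function.Bijective (matChunk (m := m) (n := n) (A := A)) :=
  (Function.Bijective.comp_left (g := chunkVec) (chunkVec_bijective n A)).comp (chunkVec_bijective m (n * A))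

end Literature.Computability.Complexity
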